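import Mathlib
import Summits.NavierStokesRegularity.NavierStokesRegularity.Theorems.MeanFieldTypeIPathLawVacuity
import Summits.NavierStokesRegularity.NavierStokesRegularity.Theses.MeanFieldTypeI
import HarnessLib

/-!
# `MeanFieldTypeI.MeanFreeLiouville` holds VACUOUSLY as typed (item stmt-NavierStokesRegularity-1682)

**Statement.** The route decl `Theses.MeanFieldTypeI.MeanFreeLiouville`, verbatim.

PROOF — AND WHY IT IS EMPTY. The item quantifies over probability measures `μ` on the function type
`ℝ → ℝ³ → ℝ³` with its instance (product) σ-algebra and assumes
`∀ᵐ u ∂μ, IsAncientMildSolution 1 u ∧ ContDiffOn ℝ ⊤ (uncurry u) (Iio 0 ×ˢ univ) ∧ …`. By the landed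
lemma `Theorems.not_ae_contDiffOn_slab` (`Theorems/MeanFieldTypeIPathLawVacuity.lean`: measurable
sets of the product σ-algebra depend on countably many times, so no probability law is carried by
jointly continuous fields) that hypothesis is contradictory, and the implication holds with nothing
to check. This makes the refuter's route-review verdict «vacuously true as typed / misstated»
(2026-08-17, evidence `Vacuity26.lean`, `MeanFieldTypeI_Vacuity.lean`) kernel-definitive: the
planner must restate the Type-I statistics over a σ-algebra that can carry path laws (e.g. a law on
a Polish path space, or the statistics of finitely many marginals) before the item has content.

HONEST FRAMING: VACUOUS. Closing this item proves nothing about statistical Type-I Liouville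
theorems, nothing about Navier–Stokes blow-up statistics, and nothing about regularity.
-/

noncomputable section

set_option linter.dupNamespace false

namespace Summit.NavierStokesRegularity.NavierStokesRegularity.Theorems

/-- **Item stmt-NavierStokesRegularity-1682** (`MeanFieldTypeI.MeanFreeLiouville`) — VACUOUSLY, as typed: its
a.e.-hypothesis on the product σ-algebra of `ℝ → ℝ³ → ℝ³` is contradictory
(`not_ae_contDiffOn_slab`). The planner should restate (refuter verdict «misstated», 2026-08-17).
[this file] -/
theorem meanFieldTypeI_meanFreeLiouville_vacuous :
    Summit.NavierStokesRegularity.NavierStokesRegularity.Theses.MeanFieldTypeI.MeanFreeLiouville := by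
  unfold Summit.NavierStokesRegularity.NavierStokesRegularity.Theses.MeanFieldTypeI.MeanFreeLiouville
  intro C M μ hM hprob hinv hgood
  exact absurd hgood (@not_ae_contDiffOn_slab μ hprob _ _)

end Summit.NavierStokesRegularity.NavierStokesRegularity.Theorems

end
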